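import Literature.Algebra.Polynomial.CasasAlvero.CharElevenComplete
import Literature.Algebra.Polynomial.CasasAlvero.CharThirteenComplete
import Literature.Algebra.Polynomial.CasasAlvero.CharSeventeenComplete
import Literature.Algebra.Polynomial.CasasAlvero.CharNineteenComplete
import Literature.Algebra.Polynomial.CasasAlvero.CharTwentyThreeComplete
import Literature.Algebra.Polynomial.CasasAlvero.CharTwentyNineComplete
import Literature.Algebra.Polynomial.CasasAlvero.CharThirtyOneComplete
import Literature.Algebra.Polynomial.CasasAlvero.CharThirtySevenComplete
import Literature.Algebra.Polynomial.CasasAlvero.CharFortyOneComplete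
import Literature.Algebra.Polynomial.CasasAlvero.CharFortyThreeComplete
import Literature.Algebra.Polynomial.CasasAlvero.CharFortySevenComplete
import Literature.Algebra.Polynomial.CasasAlvero.CharFiftyThreeComplete
import Literature.Algebra.Polynomial.CasasAlvero.CharFiftyNineComplete
import Literature.Algebra.Polynomial.CasasAlvero.CharSixtyOneComplete
import HarnessLib

/-!
# Casas-Alvero degrees in every prime characteristic `p ≤ 61`: the complete classification, one statement

For EVERY prime `p ≤ 61` and EVERY field `K` of characteristic `p` (`CA_d(K)` = `HoldsInDegree K d`: every monic Casas-Alvero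
polynomial of degree `d` over `K` is a `d`-th power):

  `CA_d(K) ⟺ d = 0 ∨ d = a·p^k with 1 ≤ a ≤ N(p)`,

where `N(2) = 1`, `N(3) = 2`, `N(5) = N(7) = 3`, `N(11) = 4`, `N(p) = 6` for `p ∈ {17, 31, 41, 43, 53, 59}` (the primes `≤ 61` that are good
for degree `6`) and `N(p) = 5` for `p ∈ {13, 19, 23, 29, 37, 47, 61}` (`classification_of_char_le_61`, assembled from the
per-characteristic classification files of this directory).  In words: below `62`, a positive-characteristic Casas-Alvero degree is `0` or a single
non-zero base-`p` digit followed by zeros, and the admissible digits are exactly `1 ≤ a ≤ min(p − 1, 6)` minus the digit `6` at the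
primes bad for degree `6` and the digit `5` at `11` — every case decided, no conditional input (`CA_5`, `CA_6` at the good primes are
the kernel-checked `Degree5.lean`, `Degree6.lean`).  [cite: GrafVonBothmerEtAl2007, Props. 2, 5, 6, 7] [cite: CastryckLaterveerOunaies2012, Thm. 4]
-/

noncomputable section

open Polynomial

namespace Literature.Algebra.Polynomial.CasasAlvero

variable (K : Type*) [Field K]

/-- reshaping `∃ k, d = p^k ∨ d = 2p^k ∨ …` into the digit form, `N = 1`. [folklore] -/
theorem digitForm_one {p d : ℕ} : (∃ k, d = p ^ k) ↔ ∃ k a : ℕ, 0 < a ∧ a ≤ 1 ∧ d = a * p ^ k := by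
  constructor
  · rintro ⟨k, rfl⟩; exact ⟨k, 1, by norm_num, le_rfl, by ring⟩
  · rintro ⟨k, a, ha0, ha1, rfl⟩; obtain rfl : a = 1 := by omega
    exact ⟨k, by ring⟩

/-- digit form, `N = 2`. [folklore] -/
theorem digitForm_two {p d : ℕ} : (∃ k, d = p ^ k ∨ d = 2 * p ^ k) ↔ ∃ k a : ℕ, 0 < a ∧ a ≤ 2 ∧ d = a * p ^ k := by
  constructor
  · rintro ⟨k, rfl | rfl⟩
    · exact ⟨k, 1, by norm_num, by norm_num, by ring⟩
    · exact ⟨k, 2, by norm_num, by norm_num, by ring⟩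
  · rintro ⟨k, a, ha0, ha1, rfl⟩
    interval_cases a
    · exact ⟨k, Or.inl (by ring)⟩
    · exact ⟨k, Or.inr rfl⟩

/-- digit form, `N = 3`. [folklore] -/
theorem digitForm_three {p d : ℕ} :
    (∃ k, d = p ^ k ∨ d = 2 * p ^ k ∨ d = 3 * p ^ k) ↔ ∃ k a : ℕ, 0 < a ∧ a ≤ 3 ∧ d = a * p ^ k := by
  constructor
  · rintro ⟨k, rfl | rfl | rfl⟩
    · exact ⟨k, 1, by norm_num, by norm_num, by ring⟩
    · exact ⟨k, 2, by norm_num, by norm_num, by ring⟩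
    · exact ⟨k, 3, by norm_num, by norm_num, by ring⟩
  · rintro ⟨k, a, ha0, ha1, rfl⟩
    interval_cases a
    · exact ⟨k, Or.inl (by ring)⟩
    · exact ⟨k, Or.inr (Or.inl rfl)⟩
    · exact ⟨k, Or.inr (Or.inr rfl)⟩

/-- digit form, `N = 4`. [folklore] -/
theorem digitForm_four {p d : ℕ} :
    (∃ k, d = p ^ k ∨ d = 2 * p ^ k ∨ d = 3 * p ^ k ∨ d = 4 * p ^ k) ↔ ∃ k a : ℕ, 0 < a ∧ a ≤ 4 ∧ d = a * p ^ k := by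
  constructor
  · rintro ⟨k, rfl | rfl | rfl | rfl⟩
    · exact ⟨k, 1, by norm_num, by norm_num, by ring⟩
    · exact ⟨k, 2, by norm_num, by norm_num, by ring⟩
    · exact ⟨k, 3, by norm_num, by norm_num, by ring⟩
    · exact ⟨k, 4, by norm_num, by norm_num, by ring⟩
  · rintro ⟨k, a, ha0, ha1, rfl⟩
    interval_cases a
    · exact ⟨k, Or.inl (by ring)⟩
    · exact ⟨k, Or.inr (Or.inl rfl)⟩
    · exact ⟨k, Or.inr (Or.inr (Or.inl rfl))⟩
    · exact ⟨k, Or.inr (Or.inr (Or.inr rfl))⟩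

/-- **Casas-Alvero degrees in every prime characteristic `p ≤ 61`, completely**: over every field of characteristic `p`,
`CA_d ⟺ d = 0 ∨ d = a·p^k` with `1 ≤ a ≤ N(p)`; `N(2) = 1`, `N(3) = 2`, `N(5) = N(7) = 3`, `N(11) = 4`, `N(p) = 6` for `p = 17, 31, 41, 43, 53, 59`,
and `N(p) = 5` for `p = 13, 19, 23, 29, 37, 47, 61`. [cite: GrafVonBothmerEtAl2007, Props. 2, 5, 6, 7] [cite: CastryckLaterveerOunaies2012, Thm. 4] -/
theorem classification_of_char_le_61 (p : ℕ) [CharP K p]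
    (hp : p ∈ ({2, 3, 5, 7, 11, 13, 17, 19, 23, 29, 31, 37, 41, 43, 47, 53, 59, 61} : Finset ℕ)) (d : ℕ) :
    HoldsInDegree K d ↔ d = 0 ∨ ∃ k a : ℕ, 0 < a ∧
      a ≤ (if p = 2 then 1 else if p = 3 then 2 else if p ≤ 7 then 3 else if p = 11 then 4
           else if p = 17 ∨ p = 31 ∨ p = 41 ∨ p = 43 ∨ p = 53 ∨ p = 59 then 6 else 5) ∧ d = a * p ^ k := by
  simp only [Finset.mem_insert, Finset.mem_singleton] at hp
  rcases hp with rfl | rfl | rfl | rfl | rfl | rfl | rfl | rfl | rfl | rfl | rfl | rfl | rfl | rfl | rfl | rfl | rfl | rfl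
  · simpa using (classification_char_two K d).trans (or_congr_right digitForm_one)
  · simpa using (classification_char_three K d).trans (or_congr_right digitForm_two)
  · simpa using (classification_char_five K d).trans (or_congr_right digitForm_three)
  · simpa using (classification_char_seven K d).trans (or_congr_right digitForm_three)
  · simpa using (classification_char_eleven_complete K d).trans (or_congr_right digitForm_four)
  · simpa using classification_char_thirteen_complete K d
  · simpa using classification_char_seventeen_complete K d
  · simpa using classification_char_nineteen_complete K d
  · simpa using classification_char_twentyThree_complete K d
  · simpa using classification_char_twentyNine_complete K d
  · simpa using classification_char_thirtyOne_complete K d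
  · simpa using classification_char_thirtySeven_complete K d
  · simpa using classification_char_fortyOne_complete K d
  · simpa using classification_char_fortyThree_complete K d
  · simpa using classification_char_fortySeven_complete K d
  · simpa using classification_char_fiftyThree_complete K d
  · simpa using classification_char_fiftyNine_complete K d
  · simpa using classification_char_sixtyOne_complete K d

/-- the primes `p ≤ 61` all qualify: the hypothesis of `classification_of_char_le_61` from `p.Prime ∧ p ≤ 61`. [folklore] -/
theorem mem_primes_le_61 {p : ℕ} (hp : p.Prime) (h61 : p ≤ 61) :
    p ∈ ({2, 3, 5, 7, 11, 13, 17, 19, 23, 29, 31, 37, 41, 43, 47, 53, 59, 61} : Finset ℕ) := by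
  interval_cases p <;> first | decide | exact absurd hp (by decide)

end Literature.Algebra.Polynomial.CasasAlvero
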